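import Summits.QuantumFields.BalabanUV.Beta.GAN24.TransportedDivFree
import Summits.QuantumFields.BalabanUV.Beta.GAN24.CombVHEWordsZeroStep
import Summits.QuantumFields.BalabanUV.Beta.GAN24.ExitFaceCurrentDivFree
import Summits.QuantumFields.BalabanUV.Beta.GAN24.LambdaSectorClassSlotOfTables

/-!
# `BalabanUV.Beta.GAN24.CombExitFaceCurrentDivFree` — binder row G-an2-4 ∕ (CONV-C), TRANSFER-III, the (III′) (C)-campaign's supplier `hB0` AT LEVELS `≥ 1`:
# **(D)_comb — THE (D)-TOWER AT THE COMB DATA, UNCONDITIONAL**: at an1's record `tabs = symTablesAn1S2 d Lc cΛt`, comb root `ρ_c = ctr (d+1) Lc`, transport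
# `𝒯 = Ψ̂_Sᵀ ∘ slotPsiS (ctrOff (d+1) Lc) Lc ∘ Ψ̂_S`, ALL pins `cE cVH cΛ`, EVERY level `j`, all slot∕leg directions `ν β`: every class-weighted two-leg current of the comb member
# `ScombOf tabs cE cVH cΛ j`, of its transport `𝒯 S̃comb_j`, and of the comb E-sector `e3OfK Lc G_j (𝒯 S̃comb_j)` is FIRST-LEG DIVERGENCE-FREE; hence the displayed hypothesis
# `hdiv` = (D)_comb of leaf-01 g86's C `CombVHEWordsZeroStep.comb_vhE_word_succ_eq_zero_of_divFree` HOLDS, and **(24)_comb AT LEVEL `j+1` — the `V^VH′ ⊗ V^E′` word of the comb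
# forcing — VANISHES GIVEN (Z)_comb ALONE** (g86 README «LOCATED» L-leaf01-g86-1, CLOSED for its (D) half).
# (G-an2-4 CRUX TEAM (2), leaf prover `b2b-balaban-gan24-formalise-leaf-01`, gen 87; journal [LEAF01-G87-INTENT-1∕2])

THE TOWER ([folklore] composition BY NAME).  Road-P2 M.43 `CombCubicStepTransport.ScombOf_succ_eq_bm_transport` reads the comb S-recursion on the bm chart:
`S̃comb_{j+1} = (cE·wE)•e3OfK Lc G_j (𝒯 S̃comb_j) + (cVH·wVH)•V + (cΛ·wΛ)•Λ_{j+1}(H)` with the (E) kernel `G_j = coDressKBmAt ρ_c Lc (KInvStep Lc j)` and ONE fixed transport `𝒯`.  The class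
slot sum kills `V` (no ff block at an1's record) and `Λ` (leaf-04 g77's table-generic `LambdaSectorClassSlotOfTables` under the record letter (LH)), so the class current of `S̃comb_{j+1}` is
`(cE·wE)×` that of the E-sector; the E-sector's is divergence-free by leaf-04 g68's tower step `ExitFaceCurrentTowerStep.divFree_e3OfK_of_divFree` applied to the LOCAL, PARITY-ODD member
`𝒯 S̃comb_j` (C §3), whose (D)-class is this gen's T-INV `TransportedDivFree.divFree_transport_of_divFree` of the (D)-class of `S̃comb_j` — the induction hypothesis.  Base: `S̃comb_0 =
S0NOf V H` = Wilson + border + Λ₀, Wilson by leaf-04's `WilsonCurrentBoxForm.divFree_wilson_current`.  The consumer bridge §3 is leaf-04's `ExitFaceCurrentDivFree.exitFace_pairCurrent_divFree`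
with `SrecAt j ↦ 𝒯 S̃comb_j` (face indicator = class datum, units = constant factor).

NOT IN PRINT; OUR BOOKKEEPING ([folklore] BY NAME; 0 `def`, 0 cited fact, 0 `def … : Prop`, 0 sorry).
HONEST FRAMING (cell contract, verbatim): «discharging `BetaPertH` makes Bałaban's UV stability UNCONDITIONAL — a real constructive-QFT result; it is NOT the continuum limit and NOT
the Clay problem.»  HONEST DEPENDENCY (verbatim): «continuum YM on T⁴ ⇐ BetaPertH ∧ nine spine estimates (0/9 proved); BetaPertH ⇐ (D1) ∧ (D4) ∧ CAP+tail; G-an2-4 gates asym, D1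
and NE2/3/4.»

## What is proved (generic `d`, `[NeZero Lc]`, an1's record, all `cΛt cE cVH cΛ`)
* §1 `tsum_classSlot_ScombOf_succ_eq` (the class slot sum of `S̃comb_{j+1}` = `(cE·wE_{j+1})×` that of the bm-read E-sector), `tsum_classSlot_ScombOf_zero_eq` (level `0`: `cE×` Wilson's).
* §2 **`divFree_ScombOf_all`** (THE COMB (D)-TOWER: every `j ν β`, all class data, every site), **`divFree_transport_ScombOf`** (the transported member, T-INV),
  **`divFree_e3OfK_transport_ScombOf`** (the comb E-sector — leaf-04's `divFree_e3OfK_SrecAt` at the comb data).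
* §3 **`comb_exitFace_pairCurrent_divFree`** — C's `hdiv` for all `sf sm cΛt cE cVH cΛ C₀ j ν β p`.
* §4 **`comb_vhE_word_succ_eq_zero_of_cellTotals`** — (24)_comb at level `j+1` GIVEN (Z)_comb (`h0`) alone.
WHAT THIS IS NOT: (Z)_comb (zero cell totals of the comb E-current) is NOT proved; the `E′⊗E′` pair form at levels `≥ 1` is NOT touched; NOT `hB0 (i ≥ 1)`; NEVER «G-an2-4 closed» as
(CONV-C); NOT D1, NOT `BetaPertH`, NOT continuum, NOT Clay.  2026-08-27; no existing file touched.
-/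

noncomputable section

open Finset
open scoped BigOperators
open Literature.MathematicalPhysics.QuantumFieldTheory
open Literature.MathematicalPhysics.QuantumFieldTheory.Balaban1983to89
open Literature.MathematicalPhysics.QuantumFieldTheory.Balaban1983to89.Beta
open ExpKernelCalculus (Site MKer comp)
open AffineAveraging (box toSite)
open AveragingContoursRooted (ctr ctrOff ctrOff_mem_box)
open OneStepResolventKernel (Fib LocStencil KInv)
open OneStepKernelFamily (KInvStep vertexOfK)
open StepJetData (wilsonA locStencil_wilsonA locStencil_smul)
open BalabanStepJetsSucc (E2 wE wVH wΛ lamCoeffK)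
open BalabanStepJets (lamCoeffOf)
open InterLevelTransport (SLam)
open Summit.QuantumFields.BalabanUV.Beta.TameKernelCalculus (trK)
open Summit.QuantumFields.BalabanUV.Beta.BorderedHessian (sgnK)
open Summit.QuantumFields.BalabanUV.Beta.AxialDressingRooted (coDressKBmAt decays_coDressKBmAt_KInvStep)
open Summit.QuantumFields.BalabanUV.Beta.HessKerDressedUnits (unitK unitS locStencil_unitS)
open Summit.QuantumFields.BalabanUV.Beta.SpineRooted (e3OfK locStencil_e3OfK S0NOf)
open Summit.QuantumFields.BalabanUV.Beta.WardLocusRecursive (SrecOf_zero)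
open Summit.QuantumFields.BalabanUV.Beta.SymAveragingHessianCounts (symVhSAt symVhSAt_inl_inl)
open Summit.QuantumFields.BalabanUV.Beta.SymSecondOrderTablesAn1 (symTablesAn1S2 symTablesAn1S2_V)
open Summit.QuantumFields.BalabanUV.Beta.CombChartStepJets (ScombOf ScombOf_eq locStencil_ScombOf)
open Summit.QuantumFields.BalabanUV.Beta.SymCorrectorKernel (psiKS)
open Summit.QuantumFields.BalabanUV.Beta.SymCorrectorFace (slotPsiS)
open Summit.QuantumFields.BalabanUV.Beta.GAN24.CombCubicStepTransport (ScombOf_succ_eq_bm_transport)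
open Summit.QuantumFields.BalabanUV.Beta.GAN24.CombTransportedBorder (pos_Lc)
open Summit.QuantumFields.BalabanUV.Beta.GAN24.ExitFaceCurrentSectorSplit (summable_slot_locStencil)
open Summit.QuantumFields.BalabanUV.Beta.GAN24.LambdaSectorClassSlotOfTables (tsum_classSlot_lamSectorK_eq_zero_of_tables tsum_classSlot_lamSectorOf_eq_zero_of_tables
  exists_locStencil_lamSectorK_of_tables exists_locStencil_lamSectorOf_of_tables)
open Summit.QuantumFields.BalabanUV.Beta.GAN24.WilsonCurrentBoxForm (divFree_wilson_current)
open Summit.QuantumFields.BalabanUV.Beta.GAN24.ExitFaceCurrentTowerStep (divFree_e3OfK_of_divFree)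
open Summit.QuantumFields.BalabanUV.Beta.GAN24.ExitFaceCurrentCellTotals (tsum_weight_current_eq_faceSlot)
open Summit.QuantumFields.BalabanUV.Beta.GAN24.ExitFaceCurrentDivFree (face_eq_class abs_facePot_le unitS_smul_inl_inl)
open Summit.QuantumFields.BalabanUV.Beta.GAN24.CombVHEWordsZeroStep (exists_locStencil_transport_ScombOf parityOdd_transport_ScombOf comb_vhE_word_succ_eq_zero_of_divFree)
open Summit.QuantumFields.BalabanUV.Beta.GAN24.TransportedDivFree (divFree_transport_of_divFree)

namespace Summit.QuantumFields.BalabanUV.Beta.GAN24.CombExitFaceCurrentDivFree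

variable {d : ℕ} {Lc : ℕ} [NeZero Lc]

/-! ## §1 The class slot sum of the comb member: only the E-sector survives -/

/-- [folklore] **LEVEL `j+1`: THE CLASS SLOT SUM OF `S̃comb_{j+1}` IS `(cE·wE_{j+1})×` THAT OF THE bm-READ E-SECTOR `e3OfK Lc G_j (𝒯 S̃comb_j)`** (M.43; the border has no ff block at an1's
record; the Λ sector dies on class slot data — leaf-04 g77's table-generic kill under (LH)). -/
theorem tsum_classSlot_ScombOf_succ_eq (cΛt cE cVH cΛ : ℝ) (j : ℕ) (ν : Fin (d + 1)) (c : ℝ) (Φ : ℤ → ℝ) {B : ℝ} (hΦ : ∀ s, |Φ s| ≤ B)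
    (v q : Site (d + 1)) (κ' β : Fin (d + 1)) :
    ∑' u : Site (d + 1), (c + (Φ (u ν + 1) - Φ (u ν))) * ScombOf (symTablesAn1S2 d Lc cΛt) cE cVH cΛ (j + 1) ν u v q (Sum.inl κ') (Sum.inl β)
      = (cE * wE d Lc (j + 1)) * ∑' u : Site (d + 1), (c + (Φ (u ν + 1) - Φ (u ν))) *
          e3OfK Lc (coDressKBmAt (ctr (d + 1) Lc) Lc (KInvStep (d := d) Lc j))
            (fun κ u => comp (comp (trK (psiKS (ctrOff (d + 1) Lc) Lc)) (slotPsiS (ctrOff (d + 1) Lc) Lc (ScombOf (symTablesAn1S2 d Lc cΛt) cE cVH cΛ j) κ u))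
              (psiKS (ctrOff (d + 1) Lc) Lc)) ν u v q (Sum.inl κ') (Sum.inl β) := by
  have hLc : 1 ≤ Lc := Nat.one_le_iff_ne_zero.mpr (NeZero.ne Lc)
  have hs : ∀ u : Site (d + 1), |c + (Φ (u ν + 1) - Φ (u ν))| ≤ |c| + (B + B) := fun u =>
    (abs_add_le _ _).trans (add_le_add le_rfl ((abs_sub _ _).trans (add_le_add (hΦ _) (hΦ _))))
  -- the E-sector and the Λ-sector are local stencil families
  obtain ⟨CM, δM, hδM, hM⟩ := exists_locStencil_transport_ScombOf (d := d) (Lc := Lc) cΛt cE cVH cΛ j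
  obtain ⟨C₁, δ₁, hδ₁, h1⟩ := locStencil_e3OfK (N := Lc) hLc (decays_coDressKBmAt_KInvStep (d := d) (ctrOff_mem_box (pos_Lc (Lc := Lc))) j) hM hδM
  -- (`ctr (d+1) Lc` is `toSite (ctrOff (d+1) Lc)` by `rfl`; re-spell the sector's locality)
  have h1' : LocStencil (e3OfK Lc (coDressKBmAt (ctr (d + 1) Lc) Lc (KInvStep (d := d) Lc j))
      (fun κ u => comp (comp (trK (psiKS (ctrOff (d + 1) Lc) Lc)) (slotPsiS (ctrOff (d + 1) Lc) Lc (ScombOf (symTablesAn1S2 d Lc cΛt) cE cVH cΛ j) κ u))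
        (psiKS (ctrOff (d + 1) Lc) Lc))) C₁ δ₁ := h1
  obtain ⟨C₃, δ₃, hδ₃, h3⟩ := exists_locStencil_lamSectorK_of_tables (d := d) (Lc := Lc) (symTablesAn1S2 d Lc cΛt).hH j
  -- entrywise: E + V + Λ, the border entry vanishing
  have ept : ∀ u : Site (d + 1), ScombOf (symTablesAn1S2 d Lc cΛt) cE cVH cΛ (j + 1) ν u v q (Sum.inl κ') (Sum.inl β) =
      (cE * wE d Lc (j + 1)) * e3OfK Lc (coDressKBmAt (ctr (d + 1) Lc) Lc (KInvStep (d := d) Lc j))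
          (fun κ u => comp (comp (trK (psiKS (ctrOff (d + 1) Lc) Lc)) (slotPsiS (ctrOff (d + 1) Lc) Lc (ScombOf (symTablesAn1S2 d Lc cΛt) cE cVH cΛ j) κ u))
            (psiKS (ctrOff (d + 1) Lc) Lc)) ν u v q (Sum.inl κ') (Sum.inl β)
        + (cΛ * wΛ d Lc (j + 1)) * SLam Lc (lamCoeffK (KInvStep (d := d) Lc (j + 1)) (E2 d Lc (j + 1)) Lc) (symTablesAn1S2 d Lc cΛt).H ν u v q (Sum.inl κ') (Sum.inl β) := by
    intro u
    rw [ScombOf_succ_eq_bm_transport]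
    simp only [Pi.add_apply, Pi.smul_apply, smul_eq_mul, symTablesAn1S2_V, symVhSAt_inl_inl, mul_zero, add_zero]
  have e : ∀ u : Site (d + 1), (c + (Φ (u ν + 1) - Φ (u ν))) * ScombOf (symTablesAn1S2 d Lc cΛt) cE cVH cΛ (j + 1) ν u v q (Sum.inl κ') (Sum.inl β) =
      (cE * wE d Lc (j + 1)) * ((c + (Φ (u ν + 1) - Φ (u ν))) * e3OfK Lc (coDressKBmAt (ctr (d + 1) Lc) Lc (KInvStep (d := d) Lc j))
          (fun κ u => comp (comp (trK (psiKS (ctrOff (d + 1) Lc) Lc)) (slotPsiS (ctrOff (d + 1) Lc) Lc (ScombOf (symTablesAn1S2 d Lc cΛt) cE cVH cΛ j) κ u))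
            (psiKS (ctrOff (d + 1) Lc) Lc)) ν u v q (Sum.inl κ') (Sum.inl β))
        + (cΛ * wΛ d Lc (j + 1)) * ((c + (Φ (u ν + 1) - Φ (u ν))) *
          SLam Lc (lamCoeffK (KInvStep (d := d) Lc (j + 1)) (E2 d Lc (j + 1)) Lc) (symTablesAn1S2 d Lc cΛt).H ν u v q (Sum.inl κ') (Sum.inl β)) := by
    intro u; rw [ept u]; ring
  have hsE := (summable_slot_locStencil h1' hδ₁ hs ν v q (Sum.inl κ') (Sum.inl β)).mul_left (cE * wE d Lc (j + 1))
  have hsL := (summable_slot_locStencil h3 hδ₃ hs ν v q (Sum.inl κ') (Sum.inl β)).mul_left (cΛ * wΛ d Lc (j + 1))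
  rw [tsum_congr e, hsE.tsum_add hsL, tsum_mul_left, tsum_mul_left,
    tsum_classSlot_lamSectorK_eq_zero_of_tables (symTablesAn1S2 d Lc cΛt).hH j ν c Φ hΦ v q (Sum.inl κ') (Sum.inl β), mul_zero, add_zero]

/-- [folklore] **LEVEL `0`: THE CLASS SLOT SUM OF `S̃comb_0 = S0NOf V H` IS `cE×` THAT OF an3's BARE WILSON TABLE** (border ff-free, Λ₀ dies on class slot data). -/
theorem tsum_classSlot_ScombOf_zero_eq (cΛt cE cVH cΛ : ℝ) (ν : Fin (d + 1)) (c : ℝ) (Φ : ℤ → ℝ) {B : ℝ} (hΦ : ∀ s, |Φ s| ≤ B)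
    (v q : Site (d + 1)) (κ' β : Fin (d + 1)) :
    ∑' u : Site (d + 1), (c + (Φ (u ν + 1) - Φ (u ν))) * ScombOf (symTablesAn1S2 d Lc cΛt) cE cVH cΛ 0 ν u v q (Sum.inl κ') (Sum.inl β)
      = cE * ∑' u : Site (d + 1), (c + (Φ (u ν + 1) - Φ (u ν))) * wilsonA d ν u v q (Sum.inl κ') (Sum.inl β) := by
  have hs : ∀ u : Site (d + 1), |c + (Φ (u ν + 1) - Φ (u ν))| ≤ |c| + (B + B) := fun u =>
    (abs_add_le _ _).trans (add_le_add le_rfl ((abs_sub _ _).trans (add_le_add (hΦ _) (hΦ _))))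
  obtain ⟨C₃, δ₃, hδ₃, h3⟩ := exists_locStencil_lamSectorOf_of_tables (d := d) (Lc := Lc) (symTablesAn1S2 d Lc cΛt).hH
  have ept : ∀ u : Site (d + 1), ScombOf (symTablesAn1S2 d Lc cΛt) cE cVH cΛ 0 ν u v q (Sum.inl κ') (Sum.inl β) =
      cE * wilsonA d ν u v q (Sum.inl κ') (Sum.inl β)
        + cΛ * SLam Lc (lamCoeffOf (KInv (N := Lc) (d := d)) Lc) (symTablesAn1S2 d Lc cΛt).H ν u v q (Sum.inl κ') (Sum.inl β) := by
    intro u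
    rw [ScombOf_eq, SrecOf_zero]
    simp only [S0NOf, Pi.add_apply, Pi.smul_apply, smul_eq_mul, symTablesAn1S2_V, symVhSAt_inl_inl, mul_zero, add_zero]
  have e : ∀ u : Site (d + 1), (c + (Φ (u ν + 1) - Φ (u ν))) * ScombOf (symTablesAn1S2 d Lc cΛt) cE cVH cΛ 0 ν u v q (Sum.inl κ') (Sum.inl β) =
      cE * ((c + (Φ (u ν + 1) - Φ (u ν))) * wilsonA d ν u v q (Sum.inl κ') (Sum.inl β))
        + cΛ * ((c + (Φ (u ν + 1) - Φ (u ν))) * SLam Lc (lamCoeffOf (KInv (N := Lc) (d := d)) Lc) (symTablesAn1S2 d Lc cΛt).H ν u v q (Sum.inl κ') (Sum.inl β)) := by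
    intro u; rw [ept u]; ring
  have hsW := (summable_slot_locStencil (locStencil_wilsonA (d := d) (zero_le_one)) one_pos hs ν v q (Sum.inl κ') (Sum.inl β)).mul_left cE
  have hsL := (summable_slot_locStencil h3 hδ₃ hs ν v q (Sum.inl κ') (Sum.inl β)).mul_left cΛ
  rw [tsum_congr e, hsW.tsum_add hsL, tsum_mul_left, tsum_mul_left,
    tsum_classSlot_lamSectorOf_eq_zero_of_tables (symTablesAn1S2 d Lc cΛt).hH ν c Φ hΦ v q (Sum.inl κ') (Sum.inl β), mul_zero, add_zero]

/-! ## §2 The comb (D)-tower -/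

/-- NOT IN PRINT; OUR BOOKKEEPING ([folklore]; **THE (D)-TOWER AT THE COMB DATA, UNCONDITIONAL**).  At an1's record, for ALL pins `cE cVH cΛ`, EVERY level `j`, all directions `ν β`, all class
data `c₁ Ψ₁ c₂ Ψ₂` (bounded `Ψ`'s) and every site `v`: the class-weighted two-leg current `I(κ′,v) = Σ'_q (c₁ + dΨ₁(q_β))·Σ'_u (c₂ + dΨ₂(u_ν))·S̃comb_j ν u v q (inl κ′)(inl β)` of the comb
member is first-leg divergence-free, `Σ_κ′ (I(κ′,v) − I(κ′,v − e_κ′)) = 0`.  Induction: Wilson base; step = §1 ⨾ leaf-04's tower step on the transported member ⨾ T-INV on the hypothesis. -/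
theorem divFree_ScombOf_all (cΛt cE cVH cΛ : ℝ) :
    ∀ (j : ℕ) (ν β : Fin (d + 1)) (c₁ : ℝ) (Ψ₁ : ℤ → ℝ) (B₁ : ℝ), (∀ s, |Ψ₁ s| ≤ B₁) → ∀ (c₂ : ℝ) (Ψ₂ : ℤ → ℝ) (B₂ : ℝ), (∀ s, |Ψ₂ s| ≤ B₂) → ∀ v : Site (d + 1),
      ∑ κ' : Fin (d + 1),
        ((∑' q : Site (d + 1), (c₁ + (Ψ₁ (q β + 1) - Ψ₁ (q β))) * ∑' u : Site (d + 1), (c₂ + (Ψ₂ (u ν + 1) - Ψ₂ (u ν))) *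
            ScombOf (symTablesAn1S2 d Lc cΛt) cE cVH cΛ j ν u v q (Sum.inl κ') (Sum.inl β))
          - ∑' q : Site (d + 1), (c₁ + (Ψ₁ (q β + 1) - Ψ₁ (q β))) * ∑' u : Site (d + 1), (c₂ + (Ψ₂ (u ν + 1) - Ψ₂ (u ν))) *
            ScombOf (symTablesAn1S2 d Lc cΛt) cE cVH cΛ j ν u (v - B6BondElimination.unitVec κ') q (Sum.inl κ') (Sum.inl β)) = 0
  | 0, ν, β, c₁, Ψ₁, B₁, _, c₂, Ψ₂, B₂, hΨ₂, v => by
    have hc : ∀ a x : ℝ, a * (cE * x) = cE * (a * x) := fun a x => by ring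
    simp only [tsum_classSlot_ScombOf_zero_eq (d := d) (Lc := Lc) cΛt cE cVH cΛ ν c₂ Ψ₂ hΨ₂, hc, tsum_mul_left, ← mul_sub, ← Finset.mul_sum]
    rw [divFree_wilson_current ν β (fun n => c₁ + (Ψ₁ (n + 1) - Ψ₁ n)) (fun n => c₂ + (Ψ₂ (n + 1) - Ψ₂ n)) v, mul_zero]
  | j + 1, ν, β, c₁, Ψ₁, B₁, hΨ₁, c₂, Ψ₂, B₂, hΨ₂, v => by
    have hLc : 1 ≤ Lc := Nat.one_le_iff_ne_zero.mpr (NeZero.ne Lc)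
    -- the transported member `𝒯 S̃comb_j`: local, parity-odd, and in the (D)-class by T-INV on the induction hypothesis
    obtain ⟨Cs, δs, hδs, hS⟩ := locStencil_ScombOf (symTablesAn1S2 d Lc cΛt) cE cVH cΛ j
    obtain ⟨CM, δM, hδM, hM⟩ := exists_locStencil_transport_ScombOf (d := d) (Lc := Lc) cΛt cE cVH cΛ j
    have hparM := parityOdd_transport_ScombOf (d := d) (Lc := Lc) cΛt cE cVH cΛ j
    have hypM := divFree_transport_of_divFree (pos_Lc (Lc := Lc)) (ctrOff_mem_box (pos_Lc (Lc := Lc))) hS hδs ν β (divFree_ScombOf_all cΛt cE cVH cΛ j ν β)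
    -- leaf-04's tower step on the member
    have hE : ∑ κ' : Fin (d + 1),
        ((∑' q : Site (d + 1), (c₁ + (Ψ₁ (q β + 1) - Ψ₁ (q β))) * ∑' u : Site (d + 1), (c₂ + (Ψ₂ (u ν + 1) - Ψ₂ (u ν))) *
            e3OfK Lc (coDressKBmAt (ctr (d + 1) Lc) Lc (KInvStep (d := d) Lc j))
              (fun κ u => comp (comp (trK (psiKS (ctrOff (d + 1) Lc) Lc)) (slotPsiS (ctrOff (d + 1) Lc) Lc (ScombOf (symTablesAn1S2 d Lc cΛt) cE cVH cΛ j) κ u))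
                (psiKS (ctrOff (d + 1) Lc) Lc)) ν u v q (Sum.inl κ') (Sum.inl β))
          - ∑' q : Site (d + 1), (c₁ + (Ψ₁ (q β + 1) - Ψ₁ (q β))) * ∑' u : Site (d + 1), (c₂ + (Ψ₂ (u ν + 1) - Ψ₂ (u ν))) *
            e3OfK Lc (coDressKBmAt (ctr (d + 1) Lc) Lc (KInvStep (d := d) Lc j))
              (fun κ u => comp (comp (trK (psiKS (ctrOff (d + 1) Lc) Lc)) (slotPsiS (ctrOff (d + 1) Lc) Lc (ScombOf (symTablesAn1S2 d Lc cΛt) cE cVH cΛ j) κ u))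
                (psiKS (ctrOff (d + 1) Lc) Lc)) ν u (v - B6BondElimination.unitVec κ') q (Sum.inl κ') (Sum.inl β)) = 0 :=
      divFree_e3OfK_of_divFree (ctrOff_mem_box (pos_Lc (Lc := Lc))) j hM hδM hparM ν β hypM c₁ Ψ₁ hΨ₁ c₂ Ψ₂ hΨ₂ v
    have hc : ∀ a x : ℝ, a * ((cE * wE d Lc (j + 1)) * x) = (cE * wE d Lc (j + 1)) * (a * x) := fun a x => by ring
    simp only [tsum_classSlot_ScombOf_succ_eq (d := d) (Lc := Lc) cΛt cE cVH cΛ j ν c₂ Ψ₂ hΨ₂, hc, tsum_mul_left, ← mul_sub, ← Finset.mul_sum]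
    rw [hE, mul_zero]

/-- NOT IN PRINT; OUR BOOKKEEPING ([folklore]; THE TRANSPORTED MEMBER).  Every class-weighted two-leg current of `𝒯 S̃comb_j = Ψ̂_Sᵀ ∘ slotPsiS (ScombOf tabs cE cVH cΛ j) ∘ Ψ̂_S` is first-leg
divergence-free (every `j ν β`, all class data) — T-INV on `divFree_ScombOf_all`. -/
theorem divFree_transport_ScombOf (cΛt cE cVH cΛ : ℝ) (j : ℕ) (ν β : Fin (d + 1))
    (c₁ : ℝ) (Ψ₁ : ℤ → ℝ) (B₁ : ℝ) (hΨ₁ : ∀ s, |Ψ₁ s| ≤ B₁) (c₂ : ℝ) (Ψ₂ : ℤ → ℝ) (B₂ : ℝ) (hΨ₂ : ∀ s, |Ψ₂ s| ≤ B₂) (v : Site (d + 1)) :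
    ∑ κ' : Fin (d + 1),
      ((∑' q : Site (d + 1), (c₁ + (Ψ₁ (q β + 1) - Ψ₁ (q β))) * ∑' u : Site (d + 1), (c₂ + (Ψ₂ (u ν + 1) - Ψ₂ (u ν))) *
          comp (comp (trK (psiKS (ctrOff (d + 1) Lc) Lc)) (slotPsiS (ctrOff (d + 1) Lc) Lc (ScombOf (symTablesAn1S2 d Lc cΛt) cE cVH cΛ j) ν u)) (psiKS (ctrOff (d + 1) Lc) Lc)
            v q (Sum.inl κ') (Sum.inl β))
        - ∑' q : Site (d + 1), (c₁ + (Ψ₁ (q β + 1) - Ψ₁ (q β))) * ∑' u : Site (d + 1), (c₂ + (Ψ₂ (u ν + 1) - Ψ₂ (u ν))) *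
          comp (comp (trK (psiKS (ctrOff (d + 1) Lc) Lc)) (slotPsiS (ctrOff (d + 1) Lc) Lc (ScombOf (symTablesAn1S2 d Lc cΛt) cE cVH cΛ j) ν u)) (psiKS (ctrOff (d + 1) Lc) Lc)
            (v - B6BondElimination.unitVec κ') q (Sum.inl κ') (Sum.inl β)) = 0 := by
  obtain ⟨Cs, δs, hδs, hS⟩ := locStencil_ScombOf (symTablesAn1S2 d Lc cΛt) cE cVH cΛ j
  exact divFree_transport_of_divFree (pos_Lc (Lc := Lc)) (ctrOff_mem_box (pos_Lc (Lc := Lc))) hS hδs ν β (divFree_ScombOf_all cΛt cE cVH cΛ j ν β) c₁ Ψ₁ B₁ hΨ₁ c₂ Ψ₂ B₂ hΨ₂ v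

/-- NOT IN PRINT; OUR BOOKKEEPING ([folklore]; THE COMB E-SECTOR — leaf-04's `divFree_e3OfK_SrecAt` AT THE COMB DATA).  For every `j`, all `ν β`, all class data `c Φ c′ Φ′` (bounded) and every `y`:
`Σ_μ (J(μ,y) − J(μ,y−e_μ)) = 0`, `J(μ,y) = Σ'_w (c + dΦ(w_β))·Σ'_t (c′ + dΦ′(t_ν))·e3OfK Lc G_j (𝒯 S̃comb_j) ν t y w (inl μ)(inl β)`, `G_j = coDressKBmAt ρ_c Lc (KInvStep Lc j)`. -/
theorem divFree_e3OfK_transport_ScombOf (cΛt cE cVH cΛ : ℝ) (j : ℕ) (ν β : Fin (d + 1))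
    (c : ℝ) (Φ : ℤ → ℝ) {B : ℝ} (hΦ : ∀ s, |Φ s| ≤ B) (c' : ℝ) (Φ' : ℤ → ℝ) {B' : ℝ} (hΦ' : ∀ s, |Φ' s| ≤ B') (y : Site (d + 1)) :
    ∑ μ : Fin (d + 1),
      ((∑' w : Site (d + 1), (c + (Φ (w β + 1) - Φ (w β))) * ∑' t : Site (d + 1), (c' + (Φ' (t ν + 1) - Φ' (t ν))) *
          e3OfK Lc (coDressKBmAt (ctr (d + 1) Lc) Lc (KInvStep (d := d) Lc j))
            (fun κ u => comp (comp (trK (psiKS (ctrOff (d + 1) Lc) Lc)) (slotPsiS (ctrOff (d + 1) Lc) Lc (ScombOf (symTablesAn1S2 d Lc cΛt) cE cVH cΛ j) κ u))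
              (psiKS (ctrOff (d + 1) Lc) Lc)) ν t y w (Sum.inl μ) (Sum.inl β))
        - ∑' w : Site (d + 1), (c + (Φ (w β + 1) - Φ (w β))) * ∑' t : Site (d + 1), (c' + (Φ' (t ν + 1) - Φ' (t ν))) *
          e3OfK Lc (coDressKBmAt (ctr (d + 1) Lc) Lc (KInvStep (d := d) Lc j))
            (fun κ u => comp (comp (trK (psiKS (ctrOff (d + 1) Lc) Lc)) (slotPsiS (ctrOff (d + 1) Lc) Lc (ScombOf (symTablesAn1S2 d Lc cΛt) cE cVH cΛ j) κ u))
              (psiKS (ctrOff (d + 1) Lc) Lc)) ν t (y - B6BondElimination.unitVec μ) w (Sum.inl μ) (Sum.inl β)) = 0 := by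
  obtain ⟨Cs, δs, hδs, hS⟩ := locStencil_ScombOf (symTablesAn1S2 d Lc cΛt) cE cVH cΛ j
  obtain ⟨CM, δM, hδM, hM⟩ := exists_locStencil_transport_ScombOf (d := d) (Lc := Lc) cΛt cE cVH cΛ j
  exact divFree_e3OfK_of_divFree (ctrOff_mem_box (pos_Lc (Lc := Lc))) j hM hδM (parityOdd_transport_ScombOf (d := d) (Lc := Lc) cΛt cE cVH cΛ j) ν β
    (divFree_transport_of_divFree (pos_Lc (Lc := Lc)) (ctrOff_mem_box (pos_Lc (Lc := Lc))) hS hδs ν β (divFree_ScombOf_all cΛt cE cVH cΛ j ν β)) c Φ hΦ c' Φ' hΦ' y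

/-! ## §3 The consumer bridge: C's displayed `hdiv` = (D)_comb, unconditionally -/

/-- NOT IN PRINT; OUR BOOKKEEPING ([folklore]; **(D)_comb — C's `hdiv`, UNCONDITIONALLY**).  At an1's record and the comb root, for all units `sf sm`, all pins `cΛt cE cVH cΛ`, every scalar
`C₀` on the cubic table, every `j`, every slot direction `ν`, face direction `β` and site `p`: the bond-resummed exit-face pair current through the dressed half vertex `X̃_{j+1}` of the
unit-changed comb E-sector `unitS sf sm (C₀ • e3OfK Lc G_j (𝒯 S̃comb_j))` is divergence-free at `p` — leaf-04's `ExitFaceCurrentDivFree.exitFace_pairCurrent_divFree` with `SrecAt j ↦ 𝒯 S̃comb_j`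
(D's `tsum_weight_current_eq_faceSlot`, the face indicator as the class datum `Lc⁻¹ + d(−Lc⁻¹·(· mod Lc))`, §2). -/
theorem comb_exitFace_pairCurrent_divFree (sf sm cΛt cE cVH cΛ C₀ : ℝ) (j : ℕ) (ν β : Fin (d + 1)) (p : Site (d + 1)) :
    ∑ b : Fin (d + 1),
      ((∑' uw : Site (d + 1) × Site (d + 1), (if uw.2 β % (Lc : ℤ) = (Lc : ℤ) - 1 then (1 : ℝ) else 0) *
        vertexOfK (unitK sf sm (coDressKBmAt (ctr (d + 1) Lc) Lc (KInvStep (d := d) Lc (j + 1)))) Lc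
          (unitS sf sm (fun κ t => C₀ • e3OfK Lc (coDressKBmAt (ctr (d + 1) Lc) Lc (KInvStep (d := d) Lc j))
            (fun κ u => comp (comp (trK (psiKS (ctrOff (d + 1) Lc) Lc)) (slotPsiS (ctrOff (d + 1) Lc) Lc (ScombOf (symTablesAn1S2 d Lc cΛt) cE cVH cΛ j) κ u))
              (psiKS (ctrOff (d + 1) Lc) Lc)) κ t)) ν uw.1 p uw.2 (Sum.inl b) (Sum.inl β)) -
       (∑' uw : Site (d + 1) × Site (d + 1), (if uw.2 β % (Lc : ℤ) = (Lc : ℤ) - 1 then (1 : ℝ) else 0) *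
        vertexOfK (unitK sf sm (coDressKBmAt (ctr (d + 1) Lc) Lc (KInvStep (d := d) Lc (j + 1)))) Lc
          (unitS sf sm (fun κ t => C₀ • e3OfK Lc (coDressKBmAt (ctr (d + 1) Lc) Lc (KInvStep (d := d) Lc j))
            (fun κ u => comp (comp (trK (psiKS (ctrOff (d + 1) Lc) Lc)) (slotPsiS (ctrOff (d + 1) Lc) Lc (ScombOf (symTablesAn1S2 d Lc cΛt) cE cVH cΛ j) κ u))
              (psiKS (ctrOff (d + 1) Lc) Lc)) κ t)) ν uw.1 (p - AffineAveraging.unitVec b) uw.2 (Sum.inl b) (Sum.inl β))) = 0 := by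
  classical
  have hLc : 1 ≤ Lc := Nat.one_le_iff_ne_zero.mpr (NeZero.ne Lc)
  have hr : ctrOff (d + 1) Lc ∈ box (d + 1) Lc := ctrOff_mem_box (pos_Lc (Lc := Lc))
  -- spell the comb root as `toSite (ctrOff (d+1) Lc)` (`rfl`) so that leaf-04's rooted lemmas rewrite
  simp only [show (ctr (d + 1) Lc : Site (d + 1)) = toSite (ctrOff (d + 1) Lc) from rfl]
  -- the rescaled, unit-changed comb E-sector is a local stencil family
  obtain ⟨CM, δM, hδM, hM⟩ := exists_locStencil_transport_ScombOf (d := d) (Lc := Lc) cΛt cE cVH cΛ j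
  obtain ⟨C₁, δ₁, hδ₁, h1⟩ := locStencil_e3OfK (N := Lc) hLc (decays_coDressKBmAt_KInvStep (d := d) hr j) hM hδM
  have hSE := locStencil_smul C₀ h1
  have hSu := locStencil_unitS (sf := sf) (sm := sm) hSE
  have hρ : ∀ w : Site (d + 1), |(if w β % (Lc : ℤ) = (Lc : ℤ) - 1 then (1 : ℝ) else 0)| ≤ 1 := fun w => by split_ifs <;> simp
  -- the pair current as the face-slot ∕ face-leg current of the bare comb E-sector, times a constant
  have ecur : ∀ (b : Fin (d + 1)) (z : Site (d + 1)),
      ∑' uw : Site (d + 1) × Site (d + 1), (if uw.2 β % (Lc : ℤ) = (Lc : ℤ) - 1 then (1 : ℝ) else 0) *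
        vertexOfK (unitK sf sm (coDressKBmAt (toSite (ctrOff (d + 1) Lc)) Lc (KInvStep (d := d) Lc (j + 1)))) Lc
          (unitS sf sm (fun κ t => C₀ • e3OfK Lc (coDressKBmAt (toSite (ctrOff (d + 1) Lc)) Lc (KInvStep (d := d) Lc j))
            (fun κ u => comp (comp (trK (psiKS (ctrOff (d + 1) Lc) Lc)) (slotPsiS (ctrOff (d + 1) Lc) Lc (ScombOf (symTablesAn1S2 d Lc cΛt) cE cVH cΛ j) κ u))
              (psiKS (ctrOff (d + 1) Lc) Lc)) κ t)) ν uw.1 z uw.2 (Sum.inl b) (Sum.inl β) =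
      ((((Lc : ℝ) * (sm * sf)) * ((((Lc ^ (j + 1 + 1) : ℕ) : ℝ)) ^ (d + 1 + 1))⁻¹) * ((sf * sm)⁻¹ * (sf⁻¹ * sf⁻¹ * C₀))) *
        ∑' w : Site (d + 1), (if w β % (Lc : ℤ) = (Lc : ℤ) - 1 then (1 : ℝ) else 0) *
          ∑' t : Site (d + 1), (if t ν % (Lc : ℤ) = (Lc : ℤ) - 1 then (1 : ℝ) else 0) *
            e3OfK Lc (coDressKBmAt (toSite (ctrOff (d + 1) Lc)) Lc (KInvStep (d := d) Lc j))
              (fun κ u => comp (comp (trK (psiKS (ctrOff (d + 1) Lc) Lc)) (slotPsiS (ctrOff (d + 1) Lc) Lc (ScombOf (symTablesAn1S2 d Lc cΛt) cE cVH cΛ j) κ u))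
                (psiKS (ctrOff (d + 1) Lc) Lc)) ν t z w (Sum.inl b) (Sum.inl β) := by
    intro b z
    have hX : ∑' w : Site (d + 1), (if w β % (Lc : ℤ) = (Lc : ℤ) - 1 then (1 : ℝ) else 0) *
        ∑' t : Site (d + 1), (if t ν % (Lc : ℤ) = (Lc : ℤ) - 1 then
          unitS sf sm (fun κ t => C₀ • e3OfK Lc (coDressKBmAt (toSite (ctrOff (d + 1) Lc)) Lc (KInvStep (d := d) Lc j))
            (fun κ u => comp (comp (trK (psiKS (ctrOff (d + 1) Lc) Lc)) (slotPsiS (ctrOff (d + 1) Lc) Lc (ScombOf (symTablesAn1S2 d Lc cΛt) cE cVH cΛ j) κ u))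
              (psiKS (ctrOff (d + 1) Lc) Lc)) κ t) ν t z w (Sum.inl b) (Sum.inl β) else 0) =
        ((sf * sm)⁻¹ * (sf⁻¹ * sf⁻¹ * C₀)) * ∑' w : Site (d + 1), (if w β % (Lc : ℤ) = (Lc : ℤ) - 1 then (1 : ℝ) else 0) *
          ∑' t : Site (d + 1), (if t ν % (Lc : ℤ) = (Lc : ℤ) - 1 then (1 : ℝ) else 0) *
            e3OfK Lc (coDressKBmAt (toSite (ctrOff (d + 1) Lc)) Lc (KInvStep (d := d) Lc j))
              (fun κ u => comp (comp (trK (psiKS (ctrOff (d + 1) Lc) Lc)) (slotPsiS (ctrOff (d + 1) Lc) Lc (ScombOf (symTablesAn1S2 d Lc cΛt) cE cVH cΛ j) κ u))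
                (psiKS (ctrOff (d + 1) Lc) Lc)) ν t z w (Sum.inl b) (Sum.inl β) := by
      have hin : ∀ w : Site (d + 1), (∑' t : Site (d + 1), (if t ν % (Lc : ℤ) = (Lc : ℤ) - 1 then
          unitS sf sm (fun κ t => C₀ • e3OfK Lc (coDressKBmAt (toSite (ctrOff (d + 1) Lc)) Lc (KInvStep (d := d) Lc j))
            (fun κ u => comp (comp (trK (psiKS (ctrOff (d + 1) Lc) Lc)) (slotPsiS (ctrOff (d + 1) Lc) Lc (ScombOf (symTablesAn1S2 d Lc cΛt) cE cVH cΛ j) κ u))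
              (psiKS (ctrOff (d + 1) Lc) Lc)) κ t) ν t z w (Sum.inl b) (Sum.inl β) else 0)) =
          ((sf * sm)⁻¹ * (sf⁻¹ * sf⁻¹ * C₀)) * ∑' t : Site (d + 1), (if t ν % (Lc : ℤ) = (Lc : ℤ) - 1 then (1 : ℝ) else 0) *
            e3OfK Lc (coDressKBmAt (toSite (ctrOff (d + 1) Lc)) Lc (KInvStep (d := d) Lc j))
              (fun κ u => comp (comp (trK (psiKS (ctrOff (d + 1) Lc) Lc)) (slotPsiS (ctrOff (d + 1) Lc) Lc (ScombOf (symTablesAn1S2 d Lc cΛt) cE cVH cΛ j) κ u))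
                (psiKS (ctrOff (d + 1) Lc) Lc)) ν t z w (Sum.inl b) (Sum.inl β) := by
        intro w
        rw [← tsum_mul_left]
        refine tsum_congr fun t => ?_
        by_cases ht : t ν % (Lc : ℤ) = (Lc : ℤ) - 1
        · rw [if_pos ht, if_pos ht, unitS_smul_inl_inl, one_mul]
        · rw [if_neg ht, if_neg ht, zero_mul, mul_zero]
      simp only [hin]
      rw [← tsum_mul_left]
      exact tsum_congr fun w => by ring
    rw [tsum_weight_current_eq_faceSlot hLc hr sf sm (j + 1) hSu hδ₁ hρ ν z (Sum.inl b) (Sum.inl β), hX]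
    ring
  -- the comb tower §2, with the face indicator as the class datum on both the slot and the leg
  set Φ : ℤ → ℝ := fun n => -((Lc : ℝ)⁻¹) * (((n % (Lc : ℤ) : ℤ) : ℝ)) with hΦ
  have hΦb : ∀ s, |Φ s| ≤ 1 := fun s => abs_facePot_le (Lc := Lc) s
  have key := divFree_e3OfK_transport_ScombOf (d := d) (Lc := Lc) cΛt cE cVH cΛ j ν β ((Lc : ℝ)⁻¹) Φ hΦb ((Lc : ℝ)⁻¹) Φ hΦb p
  have eface : ∀ n : ℤ, (Lc : ℝ)⁻¹ + (Φ (n + 1) - Φ n) = if n % (Lc : ℤ) = (Lc : ℤ) - 1 then (1 : ℝ) else 0 := fun n => by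
    simp only [hΦ]; exact face_eq_class (Lc := Lc) n
  have hUV : ∀ b : Fin (d + 1), (B6BondElimination.unitVec b : Site (d + 1)) = AffineAveraging.unitVec b := fun b =>
    funext fun l => by simp [B6BondElimination.unitVec_apply, AffineAveraging.unitVec_apply]
  simp only [eface, hUV, show (ctr (d + 1) Lc : Site (d + 1)) = toSite (ctrOff (d + 1) Lc) from rfl] at key
  simp only [ecur, ← mul_sub, ← Finset.mul_sum, key, mul_zero]

/-! ## §4 (24)_comb at level `j+1`, GIVEN (Z)_comb alone -/

/-- NOT IN PRINT; OUR BOOKKEEPING ([folklore]; **(24)_comb AT LEVEL `j+1` MODULO (Z)_comb ONLY** — leaf-01 g86's C `CombVHEWordsZeroStep.comb_vhE_word_succ_eq_zero_of_divFree` with its displayed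
`hdiv` DISCHARGED by §3).  At the comb root `ρ_c = ctr (d+1) Lc`, transport `𝒯`, record `tabs = symTablesAn1S2 d Lc cΛt`, all units, pins `cE cVH cΛ`, any border weight `c`, every `j`,
every cell bond `cb`, all axes: IF the product-form exit-face current of the untransported comb E-sector `(cE·wE_{j+1}) • e3OfK Lc G_j (𝒯 S̃comb_j)` through `X̃_{j+1}` has zero cell totals
(`h0` = (Z)_comb), THEN `Σ'_{u′} FF[(vertexOfK X̃_{j+1} Lc (unitS (𝒯 S^VH_c)) μ cb ∘ X̃_{j+1}) ∘ vertexOfK X̃_{j+1} Lc (unitS (𝒯((cE·wE_{j+1}) • e3OfK Lc G_j (𝒯 S̃comb_j)))) ν u′] = 0`. -/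
theorem comb_vhE_word_succ_eq_zero_of_cellTotals {μ ν α β : Fin (d + 1)} (sf sm cΛt cE cVH cΛ c : ℝ) (j : ℕ) (cb : Site (d + 1))
    (h0 : ∀ b : Fin (d + 1), ∑ r' ∈ box (d + 1) Lc, ∑' uw : Site (d + 1) × Site (d + 1), (if uw.2 β % (Lc : ℤ) = (Lc : ℤ) - 1 then (1 : ℝ) else 0) *
        vertexOfK (unitK sf sm (coDressKBmAt (ctr (d + 1) Lc) Lc (KInvStep (d := d) Lc (j + 1)))) Lc
          (unitS sf sm (fun κ t => (cE * wE d Lc (j + 1)) • e3OfK Lc (coDressKBmAt (ctr (d + 1) Lc) Lc (KInvStep (d := d) Lc j))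
            (fun κ u => comp (comp (trK (psiKS (ctrOff (d + 1) Lc) Lc)) (slotPsiS (ctrOff (d + 1) Lc) Lc (ScombOf (symTablesAn1S2 d Lc cΛt) cE cVH cΛ j) κ u))
              (psiKS (ctrOff (d + 1) Lc) Lc)) κ t)) ν uw.1 (toSite r') uw.2 (Sum.inl b) (Sum.inl β) = 0) :
    ∑' u' : Site (d + 1), ∑' yw : Site (d + 1) × Site (d + 1), (if yw.1 α % (Lc : ℤ) = (Lc : ℤ) - 1 then (1 : ℝ) else 0) * (if yw.2 β % (Lc : ℤ) = (Lc : ℤ) - 1 then (1 : ℝ) else 0) *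
        comp (comp (vertexOfK (unitK sf sm (coDressKBmAt (ctr (d + 1) Lc) Lc (KInvStep (d := d) Lc (j + 1)))) Lc
            (unitS sf sm (fun κ v => comp (comp (trK (psiKS (ctrOff (d + 1) Lc) Lc))
              (slotPsiS (ctrOff (d + 1) Lc) Lc (fun κ v => c • symVhSAt (ctr (d + 1) Lc) d Lc rfl κ v) κ v)) (psiKS (ctrOff (d + 1) Lc) Lc))) μ cb)
          (unitK sf sm (coDressKBmAt (ctr (d + 1) Lc) Lc (KInvStep (d := d) Lc (j + 1)))))
          (vertexOfK (unitK sf sm (coDressKBmAt (ctr (d + 1) Lc) Lc (KInvStep (d := d) Lc (j + 1)))) Lc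
            (unitS sf sm (fun κ u => comp (comp (trK (psiKS (ctrOff (d + 1) Lc) Lc)) (slotPsiS (ctrOff (d + 1) Lc) Lc
              (fun κ t => (cE * wE d Lc (j + 1)) • e3OfK Lc (coDressKBmAt (ctr (d + 1) Lc) Lc (KInvStep (d := d) Lc j))
                (fun κ u => comp (comp (trK (psiKS (ctrOff (d + 1) Lc) Lc)) (slotPsiS (ctrOff (d + 1) Lc) Lc (ScombOf (symTablesAn1S2 d Lc cΛt) cE cVH cΛ j) κ u))
                  (psiKS (ctrOff (d + 1) Lc) Lc)) κ t) κ u)) (psiKS (ctrOff (d + 1) Lc) Lc))) ν u')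
          yw.1 yw.2 (Sum.inl α) (Sum.inl β) = 0 :=
  comb_vhE_word_succ_eq_zero_of_divFree (μ := μ) (ν := ν) (α := α) (β := β) sf sm cΛt cE cVH cΛ c j cb
    (fun p => comb_exitFace_pairCurrent_divFree (d := d) (Lc := Lc) sf sm cΛt cE cVH cΛ (cE * wE d Lc (j + 1)) j ν β p) h0

end Summit.QuantumFields.BalabanUV.Beta.GAN24.CombExitFaceCurrentDivFree

end
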